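import Summits.QuantumFields.YangMills.Theorems.UnitScaleTiltProp7NormG0OfCoercive
import HarnessLib

/-!
# Route `UnitScaleTilt`, crux K1 «MinimiserStabilityRegPr» (stmt-QuantumFields-19200) — route-R E′ (A′), (N06) coercivity row `hCo` of ✓`Prop7NormG0OfCoercive.hN06_of_coerciveRow`,
# LANE II «DIVERGENCE RECOVERY AT CURVED W» (★★OWNER g29 WORD 2026-08-29T05:46Z «px4: GO-A — (B0) + (B1)-FLAT», LOCATE #60), BRICK (B0):
# **THE FORM OF `Δ_aᶜ(W)` AND THE ORTHOGONALITY OF `R_W`** — `re⟪y, Δ_aᶜ(W) y⟫ = re⟪y, Δ^η_W y⟫ + ‖R_W D*_W y‖² + a‖Q_W y‖²`, and `⟪v, Δ_W λ⟫ = ⟪R_W v, Δ_W λ⟫` for every `λ ∈ N(Q′_W)`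

Cell `ym3-torus`, width seat `ym3-torus-px4` (gen 7).  THEOREMS ONLY (0 `def`, 0 `sorry`); `--supports stmt-QuantumFields-19200 --as helper`, count-neutral.  YM₃ on T³ is a ladder rung
(R3), not d = 4, not infinite volume, not the Clay problem; nothing here claims [Balaban1985BackgroundPropagators] Thm 3.3 ∕ 3.11, `hCo`, `hN06`, `hcoS`, E′, EX, H, the crux or the gap.

THE PRINT.  [Balaban1985BackgroundPropagators] (3.26) p. 395 «`Δ_a(U) = Δ(U) + D R(U) D* + Q*(U) a Q(U)`»; (3.20)–(3.21) p. 394 «`R = R(U)` is an orthogonal projection in the Hilbert space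
`L²(Ω₀, 𝔤)` onto the subspace `ℛ = Δ^η_U N(Q′)`, `N(Q′) = {λ : Q′λ = 0}`»; (3.8) p. 392 «`D*` is the adjoint of `D`».

WHY (LOCATE #60 §0 (V1), HOME `ym3-torus-px4/g7/LOCATE-RCORE-GAMMA-px4g7.md`).  The displayed coercivity row `hCo` (print's Thm 3.11 read quantitatively at the comb slots of record
`(DeltaEtaSlot, RcombL2, Qkc)`, penalty `aQ`) concerns the operator `laplaceAK (Δ^η_W) D_W R_W D*_W Q_W Q_W† aQ` of lit ✓`B11Eq103H1Complex.laplaceAK`.  Since `R_W = RcombL2 W =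
projR (covLapSite W) (QprimeCombL2 W)` IS the orthogonal projection onto `Δ_W N(Q′_W)` (✓`RcombL2_eq_projR`, lit `projR := ((ker Q′).map Δs).starProjection`) and `D*_W = (D_W)†`
(✓`adjoint_DL2`), two elementary facts follow and are recorded here once, in generic Hilbert letters and then READ at the member:
 (i) the quadratic form splits as `re⟪y, Δ^η_W y⟫ + ‖R_W D*_W y‖² + a‖Q_W y‖²` — so `hCo` differs from the tree's curved full-Landau engine (✓`Prop7CovariantOffKernel…`, divergence term `‖D*_W y‖²`)
     ONLY through `‖R_W D*_W y‖²` versus `‖D*_W y‖²`;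
 (ii) for every gauge parameter `λ` with `Q′_W λ = 0`:  `⟪v, Δ_W λ⟫ = ⟪R_W v, Δ_W λ⟫`, hence `|⟪D*_W y, Δ_W λ⟫| ≤ ‖R_W D*_W y‖·‖Δ_W λ‖` — the ONLY way `R_W` enters the «divergence recovery» row
     (V3) of LOCATE #60 (never `P = 1 − R`, never a kernel).
Pure finite-dimensional Hilbert-space algebra; no estimate of print is asserted.

WHAT IS PROVED (ns `…Theorems.Prop7DivRecoveryForm`):
* §1 generic (`ℂ`-Hilbert, finite-dimensional): `inner_self_of_isSymmetric_idem` (`⟪v, Rv⟫ = ‖Rv‖²` for a symmetric idempotent `R`), ★`re_inner_laplaceAK_eq`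
  (`re⟪y, laplaceAK Δ D R D† Q Q† a y⟫ = re⟪y, Δy⟫ + ‖R(D†y)‖² + a‖Qy‖²`), ★`inner_eq_inner_projR_of_ker` (`Q′λ = 0 ⟹ ⟪v, Δs λ⟫ = ⟪projR Δs Q′ v, Δs λ⟫`),
  `norm_inner_le_of_ker` (`‖⟪v, Δs λ⟫‖ ≤ ‖projR Δs Q′ v‖·‖Δs λ‖`).
* §2 member readings at the slots of record: ★★`re_inner_laplaceAK_comb_eq` (the `hCo` form = `re⟪y, DeltaEtaSlot W y⟫ + ‖RcombL2 W (DstarL2 W y)‖² + aQ·‖Qkc W y‖²`),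
  ★★`inner_DstarL2_covLapSite_eq_of_ker` and `norm_inner_DstarL2_covLapSite_le_of_ker` (orthogonality (ii) at `RcombL2 ∕ covLapSite ∕ QprimeCombL2`).
HONEST SCOPE.  Bookkeeping (brick (B0) of LOCATE #60); the «divergence recovery» row and `hCo` remain OPEN; rung R3, not Clay; YM gap NOT proved.

References: T. Bałaban, CMP **99** (1985) 389–434 [Balaban1985BackgroundPropagators] ((3.8) p.392, (3.20)–(3.23) p.394, (3.26)–(3.27) p.395, Thm 3.11 p.416).
-/

set_option autoImplicit false

noncomputable section

open scoped InnerProductSpace ComplexConjugate Matrix.Norms.L2Operator BigOperators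

namespace Summit.QuantumFields.YangMills.Theorems.Prop7DivRecoveryForm

open Literature.MathematicalPhysics.QuantumFieldTheory.Balaban1983to89
open Literature.MathematicalPhysics.QuantumFieldTheory.Balaban1983to89.T3ContinuumYM3Torus
open B11Eq103H1Complex (SiteL2K BondL2K laplaceAK laplaceAK_apply projR)
open Summit.QuantumFields.YangMills.Theorems.Prop7SectET3Transport (periodsT3)
open Summit.QuantumFields.YangMills.Theorems.Prop7SectET3HilbertLetters (W₂ DL2 DstarL2 covLapSite adjoint_DL2)
open Summit.QuantumFields.YangMills.Theorems.Prop7SectET3WilsonHessian (DeltaEtaSlot)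
open Summit.QuantumFields.YangMills.Theorems.Prop7SectET3CombLetters (Qkc)
open Summit.QuantumFields.YangMills.Theorems.Prop7QprimeCombL2 (QprimeCombL2 RcombL2 RcombL2_eq_projR RcombL2_isSymmetric RcombL2_idem)

/-! ## §1 Generic Hilbert-space letters -/

section Generic

variable {E S V : Type*} [NormedAddCommGroup E] [InnerProductSpace ℂ E] [FiniteDimensional ℂ E]
  [NormedAddCommGroup S] [InnerProductSpace ℂ S] [FiniteDimensional ℂ S]
  [NormedAddCommGroup V] [InnerProductSpace ℂ V] [FiniteDimensional ℂ V]

omit [FiniteDimensional ℂ S] in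
/-- For a symmetric idempotent `R` («orthogonal projection», (3.20)): `⟪v, R v⟫ = ‖R v‖²`. [cite: Balaban1985BackgroundPropagators, (3.20)-(3.21) p.394] -/
theorem inner_self_of_isSymmetric_idem (R : S →ₗ[ℂ] S) (hR : R.IsSymmetric) (hR2 : ∀ v, R (R v) = R v) (v : S) :
    ⟪v, R v⟫_ℂ = ((‖R v‖ : ℝ) : ℂ) ^ 2 := by
  conv_lhs => rw [← hR2 v]
  rw [← hR v (R v), inner_self_eq_norm_sq_to_K]
  rfl

/-- ★ **THE FORM OF `Δ_a = Δ + D R D† + Q† a Q`**: for `R` a symmetric idempotent and a real weight `a`,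
`re⟪y, Δ_a y⟫ = re⟪y, Δ y⟫ + ‖R(D† y)‖² + a·‖Q y‖²`. [cite: Balaban1985BackgroundPropagators, (3.26) p.395, (3.8) p.392, (3.20)-(3.21) p.394] -/
theorem re_inner_laplaceAK_eq (Δ : E →ₗ[ℂ] E) (D : S →ₗ[ℂ] E) (R : S →ₗ[ℂ] S) (Q : E →ₗ[ℂ] V) (a : ℝ)
    (hR : R.IsSymmetric) (hR2 : ∀ v, R (R v) = R v) (y : E) :
    RCLike.re ⟪y, laplaceAK Δ D R (LinearMap.adjoint D) Q (LinearMap.adjoint Q) ((a : ℝ) : ℂ) y⟫_ℂ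
      = RCLike.re ⟪y, Δ y⟫_ℂ + ‖R (LinearMap.adjoint D y)‖ ^ 2 + a * ‖Q y‖ ^ 2 := by
  rw [laplaceAK_apply, inner_add_right, inner_add_right, map_add, map_add]
  have h1 : ⟪y, D (R (LinearMap.adjoint D y))⟫_ℂ = ((‖R (LinearMap.adjoint D y)‖ : ℝ) : ℂ) ^ 2 := by
    rw [← LinearMap.adjoint_inner_left, inner_self_of_isSymmetric_idem R hR hR2]
  have h2 : ⟪y, LinearMap.adjoint Q (((a : ℝ) : ℂ) • Q y)⟫_ℂ = ((a : ℝ) : ℂ) * ((‖Q y‖ : ℝ) : ℂ) ^ 2 := by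
    rw [LinearMap.adjoint_inner_right, inner_smul_right, inner_self_eq_norm_sq_to_K]
    rfl
  rw [h1, h2]
  simp only [RCLike.re_to_complex, ← Complex.ofReal_pow, ← Complex.ofReal_mul, Complex.ofReal_re]

/-- ★ **ORTHOGONALITY OF `R = projR Δs Q′`** (the orthogonal projection onto `ℛ = Δs(ker Q′)`, (3.21)): for `λ ∈ ker Q′`, `⟪v, Δs λ⟫ = ⟪R v, Δs λ⟫`.
[cite: Balaban1985BackgroundPropagators, (3.20)-(3.21) p.394] -/
theorem inner_eq_inner_projR_of_ker (Δs : S →ₗ[ℂ] S) {F' : Type*} [AddCommGroup F'] [Module ℂ F'] (Q' : S →ₗ[ℂ] F')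
    (v : S) {l : S} (hl : Q' l = 0) :
    ⟪v, Δs l⟫_ℂ = ⟪projR Δs Q' v, Δs l⟫_ℂ := by
  haveI : CompleteSpace ((LinearMap.ker Q').map Δs) := FiniteDimensional.complete ℂ _
  have hmem : Δs l ∈ (LinearMap.ker Q').map Δs := Submodule.mem_map_of_mem (LinearMap.mem_ker.2 hl)
  have h0 := Submodule.starProjection_inner_eq_zero (K := (LinearMap.ker Q').map Δs) v (Δs l) hmem
  rw [inner_sub_left, sub_eq_zero] at h0
  exact h0

/-- Hence `‖⟪v, Δs λ⟫‖ ≤ ‖R v‖·‖Δs λ‖` for `λ ∈ ker Q′`. [cite: Balaban1985BackgroundPropagators, (3.20)-(3.21) p.394] -/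
theorem norm_inner_le_of_ker (Δs : S →ₗ[ℂ] S) {F' : Type*} [AddCommGroup F'] [Module ℂ F'] (Q' : S →ₗ[ℂ] F')
    (v : S) {l : S} (hl : Q' l = 0) :
    ‖⟪v, Δs l⟫_ℂ‖ ≤ ‖projR Δs Q' v‖ * ‖Δs l‖ := by
  rw [inner_eq_inner_projR_of_ker Δs Q' v hl]
  exact norm_inner_le_norm _ _

end Generic

/-! ## §2 Member readings at the comb slots of record -/

section Member

variable (F : T3Family) (n K : ℕ) (c₀ cB : ℝ) [Fact (0 < c₀)] [Fact (0 < cB)]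

/-- ★★ **THE FORM OF THE DISPLAYED `Δ_aᶜ(W)`** (the operator of ✓`Prop7NormG0OfCoercive.hN06_of_coerciveRow`'s hypothesis `hCo`, any Hessian slot `Δx`, any real weight `aQ`):
`re⟪y, laplaceAK (Δx) D_W R_W D*_W Q_W Q_W† aQ y⟫ = re⟪y, Δx y⟫ + ‖RcombL2 W (DstarL2 W y)‖² + aQ·‖Qkc W y‖²` — so `hCo` and the curved full-Landau engine differ only in
`‖R_W D*_W y‖²` vs `‖D*_W y‖²` (LOCATE #60 (V1)–(V2)). [cite: Balaban1985BackgroundPropagators, (3.26) p.395, Thm 3.11 p.416, (3.20)-(3.21) p.394] -/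
theorem re_inner_laplaceAK_comb_eq (hnK : n ≤ K) (aQ : ℝ)
    (Δx : BondL2K ℂ 3 (periodsT3 F K) c₀ W₂ →ₗ[ℂ] BondL2K ℂ 3 (periodsT3 F K) c₀ W₂)
    (W : GaugeField (F.P K) 0 (Matrix.specialUnitaryGroup (Fin 2) ℂ)) (y : BondL2K ℂ 3 (periodsT3 F K) c₀ W₂) :
    RCLike.re ⟪y, laplaceAK Δx (DL2 F n K c₀ W) (RcombL2 F n K c₀ W) (DstarL2 F n K c₀ W)
        (Qkc F n K hnK c₀ cB W) (LinearMap.adjoint (Qkc F n K hnK c₀ cB W)) ((aQ : ℝ) : ℂ) y⟫_ℂ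
      = RCLike.re ⟪y, Δx y⟫_ℂ + ‖RcombL2 F n K c₀ W (DstarL2 F n K c₀ W y)‖ ^ 2 + aQ * ‖Qkc F n K hnK c₀ cB W y‖ ^ 2 := by
  rw [← adjoint_DL2]
  exact re_inner_laplaceAK_eq _ _ _ _ aQ (RcombL2_isSymmetric W) (RcombL2_idem W) y

/-- The same at the Hessian slot of record `DeltaEtaSlot` (the literal `hCo` operator). [cite: Balaban1985BackgroundPropagators, (3.26) p.395, (3.12) p.392, Thm 3.11 p.416] -/
theorem re_inner_laplaceAK_comb_DeltaEta_eq (hnK : n ≤ K) (aQ : ℝ)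
    (W : GaugeField (F.P K) 0 (Matrix.specialUnitaryGroup (Fin 2) ℂ)) (y : BondL2K ℂ 3 (periodsT3 F K) c₀ W₂) :
    RCLike.re ⟪y, laplaceAK (DeltaEtaSlot F n K c₀ W) (DL2 F n K c₀ W) (RcombL2 F n K c₀ W) (DstarL2 F n K c₀ W)
        (Qkc F n K hnK c₀ cB W) (LinearMap.adjoint (Qkc F n K hnK c₀ cB W)) ((aQ : ℝ) : ℂ) y⟫_ℂ
      = RCLike.re ⟪y, DeltaEtaSlot F n K c₀ W y⟫_ℂ + ‖RcombL2 F n K c₀ W (DstarL2 F n K c₀ W y)‖ ^ 2 + aQ * ‖Qkc F n K hnK c₀ cB W y‖ ^ 2 :=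
  re_inner_laplaceAK_comb_eq F n K c₀ cB hnK aQ _ W y

/-- ★★ **ORTHOGONALITY AT THE SLOT OF RECORD**: for a gauge parameter `λ` with vanishing comb site averages (`λ ∈ N(Q′_W) = ker (QprimeCombL2 W)`),
`⟪D*_W y, Δ_W λ⟫ = ⟪R_W (D*_W y), Δ_W λ⟫` (`Δ_W = covLapSite W`, `R_W = RcombL2 W`). [cite: Balaban1985BackgroundPropagators, (3.20)-(3.23) p.394] -/
theorem inner_DstarL2_covLapSite_eq_of_ker (W : GaugeField (F.P K) 0 (Matrix.specialUnitaryGroup (Fin 2) ℂ))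
    (y : BondL2K ℂ 3 (periodsT3 F K) c₀ W₂) {l : SiteL2K ℂ 3 (periodsT3 F K) c₀ W₂} (hl : QprimeCombL2 F n K c₀ W l = 0) :
    ⟪DstarL2 F n K c₀ W y, covLapSite F n K c₀ W l⟫_ℂ = ⟪RcombL2 F n K c₀ W (DstarL2 F n K c₀ W y), covLapSite F n K c₀ W l⟫_ℂ := by
  rw [RcombL2_eq_projR]
  exact inner_eq_inner_projR_of_ker _ _ _ hl

/-- The same for an arbitrary vector `v` in place of `D*_W y`. [cite: Balaban1985BackgroundPropagators, (3.20)-(3.23) p.394] -/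
theorem inner_covLapSite_eq_of_ker (W : GaugeField (F.P K) 0 (Matrix.specialUnitaryGroup (Fin 2) ℂ))
    (v : SiteL2K ℂ 3 (periodsT3 F K) c₀ W₂) {l : SiteL2K ℂ 3 (periodsT3 F K) c₀ W₂} (hl : QprimeCombL2 F n K c₀ W l = 0) :
    ⟪v, covLapSite F n K c₀ W l⟫_ℂ = ⟪RcombL2 F n K c₀ W v, covLapSite F n K c₀ W l⟫_ℂ := by
  rw [RcombL2_eq_projR]
  exact inner_eq_inner_projR_of_ker _ _ _ hl

/-- Hence `‖⟪D*_W y, Δ_W λ⟫‖ ≤ ‖R_W (D*_W y)‖·‖Δ_W λ‖` for `λ ∈ N(Q′_W)` — the test-function inequality of LOCATE #60 (V1). [cite: Balaban1985BackgroundPropagators, (3.20)-(3.23) p.394] -/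
theorem norm_inner_DstarL2_covLapSite_le_of_ker (W : GaugeField (F.P K) 0 (Matrix.specialUnitaryGroup (Fin 2) ℂ))
    (y : BondL2K ℂ 3 (periodsT3 F K) c₀ W₂) {l : SiteL2K ℂ 3 (periodsT3 F K) c₀ W₂} (hl : QprimeCombL2 F n K c₀ W l = 0) :
    ‖⟪DstarL2 F n K c₀ W y, covLapSite F n K c₀ W l⟫_ℂ‖ ≤ ‖RcombL2 F n K c₀ W (DstarL2 F n K c₀ W y)‖ * ‖covLapSite F n K c₀ W l‖ := by
  rw [inner_DstarL2_covLapSite_eq_of_ker F n K c₀ W y hl]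
  exact norm_inner_le_norm _ _

end Member

end Summit.QuantumFields.YangMills.Theorems.Prop7DivRecoveryForm

end
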